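import Summits.BirchSwinnertonDyer.BirchSwinnertonDyer.Theorems.ManinLocalTwoThreeCurveExclusionFortyFive
import HarnessLib

/-!
# Level `96 = 2⁵·3` (C2 domain, `v₂(N) = 5`, genus 9, two classes `96a`, `96b`): the CURVE-SIDE EXCLUSION ARITHMETIC

Cell `bsd-f2-manin`, route `ManinLocalTwoThree`, crux C2 `ManinOddAtFour` (stmt-BirchSwinnertonDyer-22967, `2² ∣ 96`), prover seat p1 gen 25;
`--supports stmt-BirchSwinnertonDyer-22967` (helper).  Level-`96` analogue of `…CurveExclusionFortyFour` / `…CurveExclusionOneHundredEight`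
(generic curve-side lemmas `lFunction_mul`, `lFunction_nine`, `neg_le_lFunction_prime_and_le` reused from the level-`44` file,
`lFunction_twentyFive` from the level-`45` file).

THE PLAN AT 96 (an g51 MEMO-an §96, `S₂`-variant; p3 g24's two class squeezes wait for the pinning
`…ManinConstantNinetySix.maninConstant_ninetySix_of_pinning`).  On an g51's `η`-basis `B1c…B9c` of `S₂(Γ₀(96))` (pivot columns
`1,2,3,4,5,6,7,9,11`) the reduced row-echelon form gives, among others, the five column relations
`a₁₃ = −2a₉`, `a₁₅ = −2a₃ − a₇`, `a₂₅ = −a₁`, `a₃₃ = a₁ + 2a₅ − a₉`, `a₃₅ = 2a₇` for EVERY `f ∈ S₂(Γ₀(96))`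
(`…ColumnRelationsNinetySix.columnRelations_ninetySix`).  THIS FILE proves the arithmetic consequence for an elliptic `W/ℚ` with `3 ∣ N_W`
(true for every `X₀(96)`-datum: `3 ∣ 96`, tree `IsNewformOf.dvd_level_iff_dvd_conductorNorm`) whose `L`-coefficients satisfy them:
`(a₃, a₅, a₇, a₁₁) ∈ {(1, 2, −4, 4), (−1, 2, 4, −4), (1, −2, 0, −4), (−1, −2, 0, 4)}` — the vectors of the newforms `96a`, `96b` and of the
OLD forms `ι₁φ₄₈` (`48a`), `ι₁φ₂₄` (`24a`) (excluded downstream by `old ⊓ new = ⊥`; the other six old vectors of an's `pinsolve-96.out`,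
e.g. `32a` with `a₉ = −3 ≠ a₃²`, never meet the curve side).  Inputs: `a₁ = 1`; `a₉ = a₃²` (`3 ∣ N_W`); `a₂₅ = a₅² − 𝟙(5)·5` with UNKNOWN
indicator; multiplicativity `a₁₅ = a₃a₅`, `a₃₃ = a₃a₁₁`, `a₃₅ = a₅a₇`; Hasse at `3, 5, 13` — all PROVED tree theorems.
(`a₂₅ = −1 ⟹ a₅ = ±2`; `|a₁₃| = 2a₃² ≤ 7` and `a₃a₁₁ = 1 + 2a₅ − a₃²` ⟹ `a₃ = ±1`; then `a₇`, `a₁₁` are linear.)  Exact twin: `HOME/p1/g25/gen96.py`.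

HONEST FRAMING: elementary and unconditional; nothing here proves C2, Manin's conjecture or BSD.
[cite: DiamondShurman2005, §8.8 (8.44)] [cite: SilvermanAEC2009, Thm. V.1.1] [cite: CremonaAlgorithms1997, Table 3 (N = 24, 48, 96)]
-/

set_option autoImplicit false
-- lint-debt: the directory name repeats the summit name (sibling precedent `ManinLocalTwoThreeCurveExclusionFortyFour.lean`)
set_option linter.dupNamespace false

namespace Summit.BirchSwinnertonDyer.BirchSwinnertonDyer.Theorems.ManinLocalTwoThree.LevelNinetySix

open Literature.NumberTheory.EllipticCurves

variable (W : WeierstrassCurve ℚ) [W.IsElliptic]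

/-! ## §1 Curve-side inputs at the primes `3, 5, 13` -/

/-- Hasse at `3, 5, 13`: `|a₃| ≤ 3`, `|a₅| ≤ 4`, `|a₁₃| ≤ 7` (two-sided form). [cite: SilvermanAEC2009, Thm. V.1.1] -/
theorem hasse_bounds_ninetySix : (-3 ≤ W.LFunction 3 ∧ W.LFunction 3 ≤ 3) ∧ (-4 ≤ W.LFunction 5 ∧ W.LFunction 5 ≤ 4) ∧
    (-7 ≤ W.LFunction 13 ∧ W.LFunction 13 ≤ 7) :=
  ⟨by exact_mod_cast LevelFortyFour.neg_le_lFunction_prime_and_le W Nat.prime_three (B := 3) (by norm_num),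
   by exact_mod_cast LevelFortyFour.neg_le_lFunction_prime_and_le W (p := 5) (B := 4) (by norm_num) (by norm_num),
   by exact_mod_cast LevelFortyFour.neg_le_lFunction_prime_and_le W (p := 13) (B := 7) (by norm_num) (by norm_num)⟩

/-! ## §2 The exclusion -/

/-- **The level-96 exclusion arithmetic.**  If `3 ∣ N_W` and the `L`-coefficients of an elliptic `W/ℚ` satisfy the five column relations
`a₁₃ = −2a₉`, `a₁₅ = −2a₃ − a₇`, `a₂₅ = −a₁`, `a₃₃ = a₁ + 2a₅ − a₉`, `a₃₅ = 2a₇` of `S₂(Γ₀(96))`, then `(a₃, a₅, a₇, a₁₁)` is `96a`'s `(1, 2, −4, 4)`,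
`96b`'s `(−1, 2, 4, −4)`, or one of the old vectors `(1, −2, 0, −4)` (`48a`), `(−1, −2, 0, 4)` (`24a`).
[cite: DiamondShurman2005, §8.8 (8.44)] [cite: CremonaAlgorithms1997, Table 3 (N = 24, 48, 96)] -/
theorem coeffVector_ninetySix (h3N : 3 ∣ W.conductorNorm ℤ)
    (h13 : W.LFunction 13 = -2 * W.LFunction 9)
    (h15 : W.LFunction 15 = -2 * W.LFunction 3 - W.LFunction 7)
    (h25 : W.LFunction 25 = -W.LFunction 1)
    (h33 : W.LFunction 33 = W.LFunction 1 + 2 * W.LFunction 5 - W.LFunction 9)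
    (h35 : W.LFunction 35 = 2 * W.LFunction 7) :
    (W.LFunction 3 = 1 ∧ W.LFunction 5 = 2 ∧ W.LFunction 7 = -4 ∧ W.LFunction 11 = 4) ∨
      (W.LFunction 3 = -1 ∧ W.LFunction 5 = 2 ∧ W.LFunction 7 = 4 ∧ W.LFunction 11 = -4) ∨
      (W.LFunction 3 = 1 ∧ W.LFunction 5 = -2 ∧ W.LFunction 7 = 0 ∧ W.LFunction 11 = -4) ∨
      (W.LFunction 3 = -1 ∧ W.LFunction 5 = -2 ∧ W.LFunction 7 = 0 ∧ W.LFunction 11 = 4) := by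
  obtain ⟨⟨h3l, h3u⟩, ⟨h5l, h5u⟩, ⟨h13l, h13u⟩⟩ := hasse_bounds_ninetySix W
  have hL1 : W.LFunction 1 = 1 := W.LFunction_apply_one
  -- multiplicativity at `15, 33, 35`, the `3`- and `5`-power recursions
  have m15 : W.LFunction 15 = W.LFunction 3 * W.LFunction 5 := LevelFortyFour.lFunction_mul W (m := 3) (n := 5) (by norm_num)
  have m33 : W.LFunction 33 = W.LFunction 3 * W.LFunction 11 :=
    LevelFortyFour.lFunction_mul W (m := 3) (n := 11) (by norm_num)
  have m35 : W.LFunction 35 = W.LFunction 5 * W.LFunction 7 := LevelFortyFour.lFunction_mul W (m := 5) (n := 7) (by norm_num)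
  have r9 := LevelFortyFour.lFunction_nine W
  rw [if_pos h3N, sub_zero] at r9
  have r25 := LevelFortyFive.lFunction_twentyFive W
  -- name the coefficients
  rw [hL1] at h25 h33
  rw [r9] at h13 h33
  set a3 := W.LFunction 3 with ha3
  set a5 := W.LFunction 5 with ha5
  set a7 := W.LFunction 7 with ha7
  set a11 := W.LFunction 11 with ha11
  set a13 := W.LFunction 13 with ha13
  clear_value a3 a5 a7 a11 a13
  rw [m15] at h15
  rw [m33] at h33
  rw [m35] at h35
  rw [r25] at h25
  -- Step 1: `a₅² − 𝟙(5)·5 = −1` forces `5 ∤ N_W` and `a₅ = ±2`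
  have h5v : a5 = 2 ∨ a5 = -2 := by
    split_ifs at h25 with h5N <;> clear h5N <;> interval_cases a5 <;> omega
  -- Step 2: `|a₁₃| = 2a₃² ≤ 7` and `a₃a₁₁ = 2a₅ + 1 − a₃²` (parity) force `a₃ = ±1`
  have h3v : a3 = 1 ∨ a3 = -1 := by
    clear h25
    interval_cases a3 <;> omega
  -- Step 3: `a₇` and `a₁₁` are then linear
  rcases h5v with h5 | h5 <;> rcases h3v with h3 | h3 <;> subst h5 h3
  · obtain ⟨h7, h11⟩ : a7 = -4 ∧ a11 = 4 := by omega
    subst h7 h11; norm_num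
  · obtain ⟨h7, h11⟩ : a7 = 4 ∧ a11 = -4 := by omega
    subst h7 h11; norm_num
  · obtain ⟨h7, h11⟩ : a7 = 0 ∧ a11 = -4 := by omega
    subst h7 h11; norm_num
  · obtain ⟨h7, h11⟩ : a7 = 0 ∧ a11 = 4 := by omega
    subst h7 h11; norm_num

end Summit.BirchSwinnertonDyer.BirchSwinnertonDyer.Theorems.ManinLocalTwoThree.LevelNinetySix
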